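import Summits.QuantumFields.BalabanUV.Beta.GAN24.AxProjBmWindow
import Summits.QuantumFields.BalabanUV.Beta.FP.NestedDressingProjectorBounds
import Summits.QuantumFields.BalabanUV.Beta.SymmetrisedDressingLinear
import Summits.QuantumFields.BalabanUV.Beta.SymmetrisedDressingReflection
import Summits.QuantumFields.BalabanUV.Beta.SymSliceProjectorFixed
import Summits.QuantumFields.BalabanUV.Beta.AxialDressingRootedHessian

/-!
# `BalabanUV.Beta.D1BFx.CombColumnWindows` — road «BF-x» ∕ the (III′) literal of record, binder row D1, slot (K): **«COMB-WINDOWS» — THE TWO COMB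
# GAUGES OF THE LITERAL's LEG `GcombSh = Πᵀ_{ρ} Π̂ᵀ_{sbm} K Π̂_{sbm} Π_{ρ}` ARE THEIR WINDOW MATRICES ON WEIGHT FAMILIES, so the dressed `ℋ`-COLUMNS are the PROJECTORS
# applied to the undressed column: `colH (coDressKAt ρ N K) N μ y = Π_ρ (colH K N μ y)` and `colH (coDressKSymAt ρ N K) N μ y = Π̂^{sym}_bm (colH K N μ y)` (in-block root,
# EVERY packed kernel `K`); and the COMB-CHART COLUMN IDENTITY `colH (Πᵀ_ρ Π̂ᵀ K Π̂ Π_ρ) = Π_ρ W − grad (σ^{sym}_bm W ∘ root)` — the outer comb meets the inner gauge only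
# through its ROOT VALUES** (part 1 of «GCOMB-COL-ENV»; part 2 `D1BFx/CombColumnEnvelope` reads the n-powers off it)

HONEST DEPENDENCY (cell records, verbatim): «continuum YM on T⁴ ⇐ BetaPertH ∧ nine spine estimates (0/9 proved); BetaPertH ⇐ (D1) ∧ (D4) ∧
CAP+tail; G-an2-4 gates asym, D1 and NE2/3/4.»  HONEST FRAMING (cell contract, verbatim): «discharging `BetaPertH` makes Bałaban's UV stability
UNCONDITIONAL — a real constructive-QFT result; it is NOT the continuum limit and NOT the Clay problem.»  THIS MODULE DISCHARGES NOTHING of the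
wall: [folklore] finite window bookkeeping BY NAME over LANDED objects — an2's rooted dressings and their window operators
(`AxialDressingRooted.coProjW` ∕ `colH_coDressKAt_eq` ∕ `pm_cast` ∕ `sub_mem_cube_of_near`, `SymmetrisedDressingLinear.coProjSymW` ∕ `colH_coDressKSymAt_eq`,
`SymmetrisedDressingMatrix.pmSymBm`, `SymSliceProjectorFixed.symAxProjBmAt_add`, `SymmetrisedDressingReflection.symAxProjBmAt_mulLeft`, `BorderedHessian.treeGaugeAt_add'` ∕
`treeGaugeAt_sub'`), an5's rooted projector `RootedComb.axProjAt`, an1's contours (`AveragingContours.axial_sum_grad`), gan24-p4's window file (`GAN24.AxProjBmWindow.treeGaugeAt_eq_zero_of_local`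
∕ `window_trunc_eq_sum` — §1 here is its plain-comb twin, decl by decl, and §2 its symmetrised twin), the road-FP lineage's symmetrised block-mean gauge letters
(d1-formalise-leaf-06's `FP.NestedDressingProjectorLocality.depOn_symBmGaugeAt` ∕ `symAxProjNestAt_apply_eq_of_forall`, `FP.NestedDressingProjector.symAxProjNestAt_one`,
`FP.NestedDressingProjectorBounds.abs_symBmGaugeAt_le_of_sup`, d1-p3's `CompositeCorrectorLinear.treeGaugeAt_smul`).  No definition, no `def … : Prop`, nothing cited, 0 sorry.
A LETTER FILE: NO (1.22) row, NO estimate of Bałaban's; (J1) NOT touched (PART 22's `hC₁` stays OPEN); 0 root-level binders of row D1 discharged (hW ∕ hR-sockets ∕ hSX-socket ∕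
D1Tel ∕ D1Rep = 0); (K) NOT closed; NOT D1, NOT `BetaPertH`, NOT continuum, NOT Clay.

ABSOLUTE RULE (cell charter, verbatim): «No internally-minted statement may enter as a cited fact. Every hypothesis is either kernel-proved in
this package or a verbatim quotation of a PUBLISHED theorem with page reference. The manuscript(s) under audit are NOT citable for their own
disputed steps — they are the thing under adjudication; programme-internal (2001/route/tribunal) claims are never citable.»

WHY (OWNER d1-p2 g21 `RELEG-SPEC.md` v0 §1 (L) «a `GcombSh n 0` column envelope with n-tracking — gan24-leaf-05's lane, NOT in the tree»; d1-formalise-leaf-03 g27 WORD W-2 (iii)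
«a re-grouping of the lane words in which the dressing is carried by the leg inside each word … the column envelope with n-tracking NOT (in the tree)»; the mechanism located
in g55's HANDOFF: `colH (GcombSh N 0) = Π_{ρc}(Π̂^{sym}_bm(wH-column))` needs the two window identities `coProjW = axProjAt` and `coProjSymW = symAxProjBmAt`, neither in the tree
— an2's files carry the WINDOW form (`coProjW`, `coProjSymW`), an5's ∕ d1-p3's ∕ the road-FP files carry the PROJECTOR form (`axProjAt`, `symAxProjBmAt`) with the gauge laws
and sup bounds; gan24-p4's `AxProjBmWindow` joined the two for `Π_bm` only).

CONTENT (generic `d`, in-block root `r ∈ box (d+1) N`, `1 ≤ N`).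
* §1 [folklore] THE PLAIN ROOTED COMB: `axProjAt_eq_zero_of_local` ∕ `axProjAt_congr_local` (two-block locality), `axProjAt_add_apply` ∕ `_sub_apply` ∕ `_mulLeft` ∕
  `_finset_sum_apply`, `window_of_blk`, **`axProjAt_eq_coProjW`** (`Π_ρ A (β,p) = coProjW ρ N A β p` for EVERY 1-form), `axProjAt_eq_coProjW'`, **`colH_coDressKAt_eq_axProjAt`**.
* §2 [folklore] THE SYMMETRISED BLOCK-MEAN COMB: `symAxProjBmAt_congr_local` (road-FP locality at depth 1), `symAxProjBmAt_finset_sum_apply`, **`symAxProjBmAt_eq_coProjSymW`**,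
  `symAxProjBmAt_eq_coProjSymW'`, **`colH_coDressKSymAt_eq_symAxProjBmAt`**.
* §3 [folklore] `treeGaugeAt_grad` (`λ^ρ_{grad f} x = f x − f (root x)`), **`axProjAt_grad_apply`** (`Π_ρ (grad f) (κ,x) = f (root (x+e_κ)) − f (root x)`: supported on block-crossing
  bonds, two values of `f`), **`abs_symBmGaugeAt_le_of_blockwise`** (`|A κ z| ≤ S (blk z)`, `S ≥ 0` ⇒ `|σ^{sym}_bm A (x)| ≤ 2(d+1)N·S (blk x)`), and the COMB-CHART COLUMN IDENTITY
  **`colH_combDress_eq`**: `colH (coDressKAt ρ N (coDressKSymAt ρ N K)) N μ y κ u = Π_ρ W (κ,u) − (σ(root(u+e_κ)) − σ(root u))`, `W := colH K N μ y`, `σ := σ^{sym}_bm W`.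
NOT HERE (honest): any envelope with powers of `N` (part 2); the steps `j ≥ 1`; any (1.22) unit row; which of (α)∕(β)∕(γ) the row adopts (an2's re-ruling); anything of Bałaban's.
Unit `b2b-balaban-gan24-formalise-leaf-05` (gen 56), G-an2-4 swarm leaf prover 05, road «BF-x» supplier (`colH`-weights lineage: `PeriodicArrayWrapColH` p317988,
`PackedColumnEnvelope` p326107, the (C2) `Coframe*` and (C3) `PackedAveraging*` ∕ `GhostQWordsScales` chains); INTENT «GCOMB-COL-ENV» (journal).  Not in print; our bookkeeping.
-/

noncomputable section

open Finset
open scoped BigOperators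
open Literature.MathematicalPhysics.QuantumFieldTheory
open Literature.MathematicalPhysics.QuantumFieldTheory.Balaban1983to89
open Literature.MathematicalPhysics.QuantumFieldTheory.Balaban1983to89.Beta
open ExpKernelCalculus (MKer)
open AffineAveraging (Form0 Form1 Site box toSite unitVec unitVec_apply)
open AveragingContours (blk grad axial axial_sum_grad blk_block)
open AveragingContoursRooted (treeGaugeAt)
open RootedComb (axProjAt axProjAt_apply)
open AxialProjector (zsmul_blk_le lt_zsmul_blk_add)
open OneStepResolventKernel (Fib)
open OneStepKernelFamily (colH)
open Summit.QuantumFields.BalabanUV.Beta.AxialDressingRooted (pm pm_eq pm_cast cube mem_cube bondInd bondInd_apply coDressKAt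
  coProjW coProjW_apply colH_coDressKAt_eq sub_mem_cube_of_near)
open Summit.QuantumFields.BalabanUV.Beta.BorderedHessian (treeGaugeAt_add' treeGaugeAt_sub')
open Summit.QuantumFields.BalabanUV.Beta.CompositeCorrectorLinear (treeGaugeAt_smul)
open Summit.QuantumFields.BalabanUV.Beta.SymmetrisedAxialGaugeBlockMean (symBmGaugeAt symAxProjBmAt)
open Summit.QuantumFields.BalabanUV.Beta.SymmetrisedDressingMatrix (pmSymBm bondIndR bondIndR_apply)
open Summit.QuantumFields.BalabanUV.Beta.SymmetrisedDressingKernel (coDressKSymAt)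
open Summit.QuantumFields.BalabanUV.Beta.SymmetrisedDressingLinear (coProjSymW coProjSymW_apply colH_coDressKSymAt_eq)
open Summit.QuantumFields.BalabanUV.Beta.SymSliceProjectorFixed (symAxProjBmAt_add)
open Summit.QuantumFields.BalabanUV.Beta.SymmetrisedDressingReflection (symAxProjBmAt_mulLeft)
open Summit.QuantumFields.BalabanUV.Beta.FP.NestedDressingProjector (symAxProjNestAt_one)
open Summit.QuantumFields.BalabanUV.Beta.FP.NestedDressingProjectorLocality (depOn_symBmGaugeAt symAxProjNestAt_apply_eq_of_forall)
open Summit.QuantumFields.BalabanUV.Beta.FP.NestedDressingProjectorBounds (abs_symBmGaugeAt_le_of_sup)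
open Summit.QuantumFields.BalabanUV.Beta.CompositeCorrectorLocality (mem_inBlockBond)
open Summit.QuantumFields.BalabanUV.Beta.GAN24.AxProjBmWindow (treeGaugeAt_eq_zero_of_local window_trunc_eq_sum)

namespace Summit.QuantumFields.BalabanUV.Beta.D1BFx.CombColumnWindows

variable {d : ℕ}

/-! ## §1 The plain rooted comb: `Π_ρ` IS its window matrix on weight families (`coProjW ρ N A = Π_ρ A`) -/

section PlainComb

variable {N : ℕ} {r : Fin (d + 1) → ℕ}

/-- [folklore] **LOCALITY OF `Π_ρ` (FINITE RANGE, TWO BLOCKS)**: a 1-form vanishing on the bonds based in the blocks of `p` and of `p + e_β` has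
vanishing rooted projection at `(β, p)` (`Π_ρ A = A − grad λ^ρ_A`, gan24-p4's `treeGaugeAt_eq_zero_of_local`). -/
theorem axProjAt_eq_zero_of_local (hN : 1 ≤ N) (hr : r ∈ box (d + 1) N) {A : Form1 (d + 1) ℝ} {β : Fin (d + 1)} {p : Site (d + 1)}
    (h : ∀ (κ : Fin (d + 1)) (z : Site (d + 1)), blk N z = blk N p ∨ blk N z = blk N (p + unitVec β) → A κ z = 0) :
    axProjAt (toSite r) N A β p = 0 := by
  have h0 : ∀ (κ : Fin (d + 1)) (z : Site (d + 1)), blk N z = blk N p → A κ z = 0 := fun κ z hz => h κ z (Or.inl hz)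
  have h1 : ∀ (κ : Fin (d + 1)) (z : Site (d + 1)), blk N z = blk N (p + unitVec β) → A κ z = 0 :=
    fun κ z hz => h κ z (Or.inr hz)
  rw [axProjAt_apply, treeGaugeAt_eq_zero_of_local hN hr h0, treeGaugeAt_eq_zero_of_local hN hr h1, h β p (Or.inl rfl)]
  ring

/-- [folklore] `Π_ρ` is additive in the form, pointwise (an2's `treeGaugeAt_add'`). -/
theorem axProjAt_add_apply (ρ : Fin (d + 1) → ℤ) (N : ℕ) (A B : Form1 (d + 1) ℝ) (β : Fin (d + 1)) (p : Site (d + 1)) :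
    axProjAt ρ N (A + B) β p = axProjAt ρ N A β p + axProjAt ρ N B β p := by
  simp only [axProjAt_apply, treeGaugeAt_add', Pi.add_apply]
  ring

/-- [folklore] `Π_ρ` is subtractive in the form, pointwise (an2's `treeGaugeAt_sub'`). -/
theorem axProjAt_sub_apply (ρ : Fin (d + 1) → ℤ) (N : ℕ) (A B : Form1 (d + 1) ℝ) (β : Fin (d + 1)) (p : Site (d + 1)) :
    axProjAt ρ N (A - B) β p = axProjAt ρ N A β p - axProjAt ρ N B β p := by
  simp only [axProjAt_apply, treeGaugeAt_sub', Pi.sub_apply]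
  ring

/-- [folklore] `Π_ρ` is homogeneous in the form, pointwise (d1-p3's `treeGaugeAt_smul`). -/
theorem axProjAt_mulLeft (ρ : Fin (d + 1) → ℤ) (N : ℕ) (c : ℝ) (A : Form1 (d + 1) ℝ) (β : Fin (d + 1)) (p : Site (d + 1)) :
    axProjAt ρ N (fun κ z => c * A κ z) β p = c * axProjAt ρ N A β p := by
  have e : (fun κ z => c * A κ z) = c • A := by
    funext κ z
    simp only [Pi.smul_apply, smul_eq_mul]
  rw [e, axProjAt_apply, axProjAt_apply, treeGaugeAt_smul, treeGaugeAt_smul, Pi.smul_apply, Pi.smul_apply, smul_eq_mul]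
  ring

/-- [folklore] `Π_ρ` of a finite sum of forms, pointwise. -/
theorem axProjAt_finset_sum_apply {ι : Type*} (s : Finset ι) (F : ι → Form1 (d + 1) ℝ) (ρ : Fin (d + 1) → ℤ) (N : ℕ)
    (β : Fin (d + 1)) (p : Site (d + 1)) :
    axProjAt ρ N (∑ i ∈ s, F i) β p = ∑ i ∈ s, axProjAt ρ N (F i) β p := by
  let Φ : Form1 (d + 1) ℝ →+ ℝ := AddMonoidHom.mk' (fun A => axProjAt ρ N A β p) (fun A B => axProjAt_add_apply ρ N A B β p)
  exact map_sum Φ F s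

/-- [folklore] `Π_ρ A (β, p)` depends on `A` only through the bonds based in the blocks of `p` and `p + e_β`. -/
theorem axProjAt_congr_local (hN : 1 ≤ N) (hr : r ∈ box (d + 1) N) {A A' : Form1 (d + 1) ℝ} {β : Fin (d + 1)} {p : Site (d + 1)}
    (h : ∀ (κ : Fin (d + 1)) (z : Site (d + 1)), blk N z = blk N p ∨ blk N z = blk N (p + unitVec β) → A κ z = A' κ z) :
    axProjAt (toSite r) N A β p = axProjAt (toSite r) N A' β p := by
  have e : A = A' + (A - A') := by abel
  rw [e, axProjAt_add_apply,
    axProjAt_eq_zero_of_local hN hr (A := A - A') (fun κ z hz => by rw [Pi.sub_apply, Pi.sub_apply, h κ z hz, sub_self]), add_zero]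

/-- [folklore] A bond based in the block of `p` or of `p + e_β` lies in the `N`-window of `p` (read both ways). -/
theorem window_of_blk (hN : 1 ≤ N) {κ β : Fin (d + 1)} {z p : Site (d + 1)}
    (hz : blk N z = blk N p ∨ blk N z = blk N (p + unitVec β)) : z - p ∈ cube (d + 1) N ∧ p - z ∈ cube (d + 1) N := by
  have hw : z - p ∈ cube (d + 1) N := by
    rcases hz with hz | hz
    · exact sub_mem_cube_of_near hN (κ := κ) (Or.inl hz)
    · rw [mem_cube]
      intro i
      have a1 := zsmul_blk_le hN z i
      have a2 := lt_zsmul_blk_add hN z i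
      have b1 := zsmul_blk_le hN (p + unitVec β) i
      have b2 := lt_zsmul_blk_add hN (p + unitVec β) i
      rw [hz] at a1 a2
      rw [Pi.add_apply, unitVec_apply] at b1 b2
      rw [Pi.sub_apply, abs_le]
      by_cases hi : i = β
      · rw [if_pos hi] at b1 b2; constructor <;> omega
      · rw [if_neg hi] at b1 b2; constructor <;> omega
  refine ⟨hw, ?_⟩
  rw [mem_cube] at hw ⊢
  intro i
  rw [Pi.sub_apply, ← abs_neg, neg_sub]
  exact hw i

/-- [folklore] **`Π_ρ` IS ITS WINDOW MATRIX ON WEIGHT FAMILIES** (in-block root, `N ≥ 1`; the plain-comb twin of gan24-p4's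
`AxProjBmWindow.axProjBmAt_eq_coProjBmW`): for EVERY 1-form `A` and every bond `(β, p)`,
`Π_ρ A (β, p) = Σ_{v ∈ cube} Σ_α pm ρ N β p α (p − v) · A α (p − v) = coProjW ρ N A β p` — locality (only the window is read) and additivity ∕
homogeneity of `Π_ρ` on the finite window decomposition into bond indicators, whose projections are the matrix entries `pm` (`pm_cast`). -/
theorem axProjAt_eq_coProjW (hN : 1 ≤ N) (hr : r ∈ box (d + 1) N) (A : Form1 (d + 1) ℝ) (β : Fin (d + 1)) (p : Site (d + 1)) :
    axProjAt (toSite r) N A β p = coProjW (toSite r) N A β p := by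
  -- only the window is read
  have hloc : axProjAt (toSite r) N A β p
      = axProjAt (toSite r) N (fun κ z => if p - z ∈ cube (d + 1) N then A κ z else 0) β p := by
    refine axProjAt_congr_local hN hr fun κ z hz => ?_
    rw [if_pos (window_of_blk hN (κ := κ) hz).2]
  rw [hloc, window_trunc_eq_sum, coProjW_apply]
  -- additivity and homogeneity on the finite decomposition
  rw [show (fun κ z => ∑ v ∈ cube (d + 1) N, ∑ α : Fin (d + 1), A α (p - v) * (bondInd α (p - v) κ z : ℝ))
      = ∑ v ∈ cube (d + 1) N, ∑ α : Fin (d + 1), (fun κ z => A α (p - v) * (bondInd α (p - v) κ z : ℝ)) by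
    funext κ z; simp only [Finset.sum_apply], axProjAt_finset_sum_apply]
  refine Finset.sum_congr rfl fun v _ => ?_
  rw [axProjAt_finset_sum_apply]
  refine Finset.sum_congr rfl fun α _ => ?_
  rw [axProjAt_mulLeft, mul_comm, pm_cast]

/-- [folklore] The same as an identity of 1-forms. -/
theorem axProjAt_eq_coProjW' (hN : 1 ≤ N) (hr : r ∈ box (d + 1) N) (A : Form1 (d + 1) ℝ) :
    axProjAt (toSite r) N A = coProjW (toSite r) N A :=
  funext fun β => funext fun p => axProjAt_eq_coProjW hN hr A β p

/-- [folklore] **THE `Πᵀ_ρ K Π_ρ`-DRESSED `ℋ`-COLUMN IS `Π_ρ` OF THE UNDRESSED ONE** (operator form of an2's `colH_coDressKAt_eq`):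
`colH (coDressKAt ρ N K) N μ y = Π_ρ (colH K N μ y)`, in-block root. -/
theorem colH_coDressKAt_eq_axProjAt (hN : 1 ≤ N) (hr : r ∈ box (d + 1) N) (K : MKer (d + 1) (Fib d)) (μ : Fin (d + 1)) (y : Site (d + 1)) :
    colH (coDressKAt (toSite r) N K) N μ y = axProjAt (toSite r) N (colH K N μ y) := by
  rw [colH_coDressKAt_eq, axProjAt_eq_coProjW' hN hr]

end PlainComb

/-! ## §2 The block-mean-normalised SYMMETRISED comb: `Π̂^{sym}_bm` IS its window matrix on weight families (`coProjSymW ρ N A = Π̂^{sym}_bm A`) -/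

section SymComb

variable {N : ℕ} {r : Fin (d + 1) → ℕ}

/-- [folklore] `Π̂^{sym}_bm A (β, p)` depends on `A` only through the bonds based in the blocks of `p` and `p + e_β` (the road-FP locality letter
`NestedDressingProjectorLocality.symAxProjNestAt_apply_eq_of_forall` at depth `m = 1`, `symAxProjNestAt_one`). -/
theorem symAxProjBmAt_congr_local (hN : 1 ≤ N) (hr : r ∈ box (d + 1) N) {A A' : Form1 (d + 1) ℝ} {β : Fin (d + 1)} {p : Site (d + 1)}
    (h : ∀ (κ : Fin (d + 1)) (z : Site (d + 1)), blk N z = blk N p ∨ blk N z = blk N (p + unitVec β) → A κ z = A' κ z) :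
    symAxProjBmAt (toSite r) N A β p = symAxProjBmAt (toSite r) N A' β p := by
  have key := symAxProjNestAt_apply_eq_of_forall (d := d + 1) hN hr 1 β p (A := A) (B := A') (h β p (Or.inl rfl))
    (fun κ' z hz _ => h κ' z (Or.inl (by rwa [pow_one] at hz)))
    (fun κ' z hz _ => h κ' z (Or.inr (by rwa [pow_one] at hz)))
  rwa [symAxProjNestAt_one] at key

/-- [folklore] `Π̂^{sym}_bm` of a finite sum of forms, pointwise (an2's `symAxProjBmAt_add`). -/
theorem symAxProjBmAt_finset_sum_apply {ι : Type*} (s : Finset ι) (F : ι → Form1 (d + 1) ℝ) (ρ : Site (d + 1)) (N : ℕ)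
    (β : Fin (d + 1)) (p : Site (d + 1)) :
    symAxProjBmAt ρ N (∑ i ∈ s, F i) β p = ∑ i ∈ s, symAxProjBmAt ρ N (F i) β p := by
  let Φ : Form1 (d + 1) ℝ →+ ℝ := AddMonoidHom.mk' (fun A => symAxProjBmAt ρ N A β p) (fun A B => by
    show symAxProjBmAt ρ N (A + B) β p = symAxProjBmAt ρ N A β p + symAxProjBmAt ρ N B β p
    rw [symAxProjBmAt_add]; rfl)
  exact map_sum Φ F s

/-- [folklore] **`Π̂^{sym}_bm` IS ITS WINDOW MATRIX ON WEIGHT FAMILIES** (in-block root, `N ≥ 1`): for EVERY 1-form `A` and every bond `(β, p)`,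
`Π̂^{sym}_bm A (β, p) = Σ_{v ∈ cube} Σ_α pmSymBm ρ N β p α (p − v) · A α (p − v) = coProjSymW ρ N A β p` (`pmSymBm ρ N β p α q = Π̂^{sym}_bm δ_{(α,q)} (β, p)`
by definition; locality §2 + an2's `symAxProjBmAt_add` ∕ `symAxProjBmAt_mulLeft`). -/
theorem symAxProjBmAt_eq_coProjSymW (hN : 1 ≤ N) (hr : r ∈ box (d + 1) N) (A : Form1 (d + 1) ℝ) (β : Fin (d + 1)) (p : Site (d + 1)) :
    symAxProjBmAt (toSite r) N A β p = coProjSymW (toSite r) N A β p := by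
  have hloc : symAxProjBmAt (toSite r) N A β p
      = symAxProjBmAt (toSite r) N (fun κ z => if p - z ∈ cube (d + 1) N then A κ z else 0) β p := by
    refine symAxProjBmAt_congr_local hN hr fun κ z hz => ?_
    rw [if_pos (window_of_blk hN (κ := κ) hz).2]
  rw [hloc, window_trunc_eq_sum, coProjSymW_apply]
  rw [show (fun κ z => ∑ v ∈ cube (d + 1) N, ∑ α : Fin (d + 1), A α (p - v) * (bondInd α (p - v) κ z : ℝ))
      = ∑ v ∈ cube (d + 1) N, ∑ α : Fin (d + 1), (fun κ z => A α (p - v) * (bondInd α (p - v) κ z : ℝ)) by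
    funext κ z; simp only [Finset.sum_apply], symAxProjBmAt_finset_sum_apply]
  refine Finset.sum_congr rfl fun v _ => ?_
  rw [symAxProjBmAt_finset_sum_apply]
  refine Finset.sum_congr rfl fun α _ => ?_
  rw [symAxProjBmAt_mulLeft, mul_comm]
  rfl

/-- [folklore] The same as an identity of 1-forms. -/
theorem symAxProjBmAt_eq_coProjSymW' (hN : 1 ≤ N) (hr : r ∈ box (d + 1) N) (A : Form1 (d + 1) ℝ) :
    symAxProjBmAt (toSite r) N A = coProjSymW (toSite r) N A :=
  funext fun β => funext fun p => symAxProjBmAt_eq_coProjSymW hN hr A β p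

/-- [folklore] **THE `Π̂ᵀ K Π̂`-DRESSED `ℋ`-COLUMN IS `Π̂^{sym}_bm` OF THE UNDRESSED ONE** (operator form of an2's `colH_coDressKSymAt_eq`):
`colH (coDressKSymAt ρ N K) N μ y = Π̂^{sym}_bm (colH K N μ y)`, in-block root. -/
theorem colH_coDressKSymAt_eq_symAxProjBmAt (hN : 1 ≤ N) (hr : r ∈ box (d + 1) N) (K : MKer (d + 1) (Fib d)) (μ : Fin (d + 1))
    (y : Site (d + 1)) :
    colH (coDressKSymAt (toSite r) N K) N μ y = symAxProjBmAt (toSite r) N (colH K N μ y) := by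
  rw [colH_coDressKSymAt_eq, symAxProjBmAt_eq_coProjSymW' hN hr]

end SymComb

/-! ## §3 `Π_ρ` on an exact form is the gradient of the root values; the symmetrised block-mean gauge keeps a blockwise envelope -/

section Gauges

variable {N : ℕ} {r : Fin (d + 1) → ℕ}

/-- [folklore] The rooted tree integral of an exact form telescopes: `λ^ρ_{grad f}(x) = f x − f (root of the block of x)` (`axial_sum_grad`). -/
theorem treeGaugeAt_grad (ρ : Site (d + 1)) (f : Form0 (d + 1) ℝ) (L : ℕ) (x : Site (d + 1)) :
    treeGaugeAt ρ (grad f) L x = f x - f ((L : ℤ) • blk L x + ρ) := by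
  unfold treeGaugeAt
  exact axial_sum_grad f _ x

/-- [folklore] **`Π_ρ` OF AN EXACT FORM IS THE GRADIENT OF THE ROOT VALUES**: `Π_ρ (grad f) (κ, x) = f (root (x + e_κ)) − f (root x)` — supported on
the block-CROSSING bonds only, and bounded by two values of `f`. -/
theorem axProjAt_grad_apply (ρ : Site (d + 1)) (L : ℕ) (f : Form0 (d + 1) ℝ) (κ : Fin (d + 1)) (x : Site (d + 1)) :
    axProjAt ρ L (grad f) κ x = f ((L : ℤ) • blk L (x + unitVec κ) + ρ) - f ((L : ℤ) • blk L x + ρ) := by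
  rw [axProjAt_apply, treeGaugeAt_grad, treeGaugeAt_grad]
  simp only [grad]
  ring

/-- [folklore] **THE SYMMETRISED BLOCK-MEAN GAUGE OF A FORM WITH A BLOCKWISE ENVELOPE** (in-block root): if `|A κ z| ≤ S (blk N z)` with `S ≥ 0`, then
`|σ^{sym}_bm A (x)| ≤ 2(d+1)N · S (blk N x)` — `σ^{sym}_bm A (x)` reads only the bonds inside the block of `x` (road-FP `depOn_symBmGaugeAt`), where the
envelope is the constant `S (blk N x)` (road-FP `abs_symBmGaugeAt_le_of_sup`). -/
theorem abs_symBmGaugeAt_le_of_blockwise (hN : 1 ≤ N) (hr : r ∈ box (d + 1) N) {A : Form1 (d + 1) ℝ} {S : Site (d + 1) → ℝ}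
    (hS : ∀ b, 0 ≤ S b) (hA : ∀ κ z, |A κ z| ≤ S (blk N z)) (x : Site (d + 1)) :
    |symBmGaugeAt (toSite r) A N x| ≤ 2 * (((d + 1 : ℕ) : ℝ) * N * S (blk N x)) := by
  classical
  set A' : Form1 (d + 1) ℝ := fun κ z => if blk N z = blk N x then A κ z else 0 with hA'
  have hdep : symBmGaugeAt (toSite r) A N x = symBmGaugeAt (toSite r) A' N x :=
    (depOn_symBmGaugeAt (d := d + 1) hN hr x).eq fun κ z hz => by
      rw [mem_inBlockBond] at hz
      simp only [hA', if_pos hz.1]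
  rw [hdep]
  have hb : ∀ κ z, |A' κ z| ≤ S (blk N x) := fun κ z => by
    simp only [hA']
    split_ifs with h
    · rw [← h]; exact hA κ z
    · rw [abs_zero]; exact hS _
  exact abs_symBmGaugeAt_le_of_sup (d := d + 1) hN hr (hS (blk N x)) hb x

/-- [folklore] **THE COMB-CHART COLUMN IDENTITY** (in-block root `ρ = toSite r`, both dressings at the same root, ANY packed kernel `K`):
`colH (coDressKAt ρ N (coDressKSymAt ρ N K)) N μ y κ u = Π_ρ W (κ, u) − (σ (root (u + e_κ)) − σ (root u))`, `W := colH K N μ y`, `σ := σ^{sym}_bm W` —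
the outer comb projector meets the inner symmetrised gauge only through its ROOT VALUES (§3), so the two gauges cost one power of `N` JOINTLY. -/
theorem colH_combDress_eq (hN : 1 ≤ N) (hr : r ∈ box (d + 1) N) (K : MKer (d + 1) (Fib d)) (μ : Fin (d + 1)) (y : Site (d + 1))
    (κ : Fin (d + 1)) (u : Site (d + 1)) :
    colH (coDressKAt (toSite r) N (coDressKSymAt (toSite r) N K)) N μ y κ u
      = axProjAt (toSite r) N (colH K N μ y) κ u
        - (symBmGaugeAt (toSite r) (colH K N μ y) N ((N : ℤ) • blk N (u + unitVec κ) + toSite r)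
            - symBmGaugeAt (toSite r) (colH K N μ y) N ((N : ℤ) • blk N u + toSite r)) := by
  rw [colH_coDressKAt_eq_axProjAt hN hr, colH_coDressKSymAt_eq_symAxProjBmAt hN hr]
  change axProjAt (toSite r) N (colH K N μ y - grad (symBmGaugeAt (toSite r) (colH K N μ y) N)) κ u = _
  rw [axProjAt_sub_apply, axProjAt_grad_apply]

end Gauges

end Summit.QuantumFields.BalabanUV.Beta.D1BFx.CombColumnWindows

end
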